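import Literature.AlgebraicTopology.SingularHomology.CupProduct
import Literature.AlgebraicTopology.SingularHomology.TwistedPrism
import HarnessLib

/-!
# Graded commutativity of the cup product (Hatcher, Theorem 3.11)

A. Hatcher, *Algebraic Topology*, CUP 2002, §3.2, Theorem 3.11: for `α ∈ Hᵖ(X; R)`,
`β ∈ Hᵠ(X; R)` and `R` commutative, `α ⌣ β = (-1)^{pq} β ⌣ α`. This file proves the named fact
`Literature.AlgebraicTopology.SingularHomology.cupProduct_gradedComm` of
`Literature.AlgebraicTopology.SingularHomology.CupProduct` (the case `A = ∅` of Thm. 3.11, which is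
how the fact is vendored): `cupProduct_gradedComm_holds`.

We follow Hatcher's proof (pp. 270–272 of the held copy `book:hatchernd-algebraic-topology`) on
the cochain level, cochains being the honest functions
`SingularSimplex X n → R` of `Literature.AlgebraicTopology.SingularHomology.SingularCochains`:

* `SingularSimplex.vmap g σ`: restriction of a singular `n`-simplex along the affine map
  `Δᵐ → Δⁿ` induced by an arbitrary *vertex map* `g : Fin (m+1) → Fin (n+1)` (Mathlib's
  `stdSimplex.map g`, which for monotone `g` is the simplicial structure of `TopCat.toSSet`, so
  faces and front/back faces are `vmap`s: `face_eq_vmap`, `frontFace_eq_vmap`, `backFace_eq_vmap`);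
* `rhoCochain n = ρ♯`: `(ρ♯φ)(σ) = εₙ φ(σ|[vₙ, …, v₀])`, a cochain map (`d_rhoCochain`);
* `prismCochain n = P♯`, the dual of Hatcher's twisted prism operator
  `P(σ) = ∑ᵢ (-1)ⁱ εₙ₋ᵢ σ|[v₀, …, vᵢ, vₙ, …, vᵢ]`, with `P♯δ + δP♯ = ρ♯ - 𝟙`
  (`prismCochain_d_add_d_prismCochain`; the double-sum cancellation is the generic identity
  `TwistedPrism.sum_eq_mul` of `Literature.AlgebraicTopology.SingularHomology.TwistedPrism`);
* hence `ρ^* = 𝟙` on `Hⁿ(X; R)` (`π_rhoCocycle`), and the cochain formula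
  `ρ♯φ ⌣ ρ♯ψ = (-1)^{pq} ρ♯(ψ ⌣ φ)` (`cochainCup_rhoCochain`, from `ε_{p+q} = (-1)^{pq} ε_p ε_q`)
  gives the theorem on passing to cohomology classes.

Only the absolute case is treated (the vendored fact is absolute); no relative cup product is
defined in the tree.

## References

* A. Hatcher, *Algebraic Topology*, CUP 2002, §3.2, Theorem 3.11 and its proof.
-/

noncomputable section

open CategoryTheory Limits AlgebraicTopology Simplicial Opposite

universe u v

namespace Literature.AlgebraicTopology.SingularHomology

variable (R : Type v) [CommRing R]
variable {X Y : Type u} [TopologicalSpace X] [TopologicalSpace Y]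

/-! ### Restriction of singular simplices along arbitrary vertex maps -/

namespace SingularSimplex

variable {m n k : ℕ}

/-- Restriction `σ ∘ [e_{g 0}, …, e_{g m}]` of a singular `n`-simplex `σ : Δⁿ → X` along the affine
map `Δᵐ → Δⁿ` sending the vertex `eⱼ` to `e_{g j}`, for an arbitrary (not necessarily monotone)
vertex map `g : Fin (m+1) → Fin (n+1)`; e.g. Hatcher's `σ̄ = σ|[vₙ, …, v₀]` is `σ.vmap Fin.rev`
(Hatcher 2002, §3.2, proof of Thm. 3.11: "preceding `σ` by the linear homeomorphism …
reversing the order of the vertices"). The affine map is Mathlib's `stdSimplex.map g`, so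
that for monotone `g` this is *definitionally* the simplicial structure of `TopCat.toSSet`
(`vmap_eq_map`, `face_eq_vmap` are `rfl`); it agrees with
`SingularSimplex.compose σ (stdSimplex.vertex ∘ g)` of
`Literature.AlgebraicTopology.SingularHomology.Subdivision` by
`StdSimplex.stdSimplex_map_eq_affComb` (not imported here). [cite: Hatcher2002, §3.2 proof of Thm. 3.11] -/
def vmap (g : Fin (m + 1) → Fin (n + 1)) (σ : SingularSimplex X n) : SingularSimplex X m :=
  ULift.up (TopCat.uliftFunctor.map
    (TopCat.ofHom ⟨stdSimplex.map g, stdSimplex.continuous_map g⟩) ≫ σ.down)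

/-- For a monotone vertex map, i.e. a morphism `f : ⦋m⦌ ⟶ ⦋n⦌` of the simplex category, `vmap ⇑f`
is the simplicial structure map `f^*` of the singular simplicial set (by definition of
`TopCat.toSSet` and `SimplexCategory.toTop`). [folklore] -/
lemma vmap_eq_map (f : (⦋m⦌ : SimplexCategory) ⟶ ⦋n⦌) (σ : SingularSimplex X n) :
    σ.vmap ⇑f.toOrderHom = (TopCat.toSSet.obj (TopCat.of X)).map f.op σ :=
  rfl

/-- The continuous map of `σ.vmap g` is `σ ∘ stdSimplex.map g`. [folklore] -/
lemma toContinuousMap_vmap (g : Fin (m + 1) → Fin (n + 1)) (σ : SingularSimplex X n) :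
    toContinuousMap (σ.vmap g) =
      (toContinuousMap σ).comp ⟨stdSimplex.map g, stdSimplex.continuous_map g⟩ :=
  rfl

/-- Functoriality of restriction along vertex maps: `(σ ∘ [g]) ∘ [g'] = σ ∘ [g ∘ g']`
(Hatcher 2002, §3.2, proof of Thm. 3.11: faces of `σ̄` and of the prism simplices are again
restrictions of `σ`). [cite: Hatcher2002, §3.2 proof of Thm. 3.11] -/
@[simp]
lemma vmap_vmap (g : Fin (m + 1) → Fin (n + 1)) (g' : Fin (k + 1) → Fin (m + 1))
    (σ : SingularSimplex X n) : (σ.vmap g).vmap g' = σ.vmap (g ∘ g') := by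
  apply toContinuousMap.injective
  rw [toContinuousMap_vmap, toContinuousMap_vmap, toContinuousMap_vmap, ContinuousMap.comp_assoc]
  congr 1
  ext x : 1
  exact stdSimplex.map_comp_apply _ _ x

/-- Restriction along the identity vertex map is the identity. [folklore] -/
@[simp]
lemma vmap_id (σ : SingularSimplex X n) : σ.vmap id = σ := by
  apply toContinuousMap.injective
  rw [toContinuousMap_vmap]
  ext x : 1
  simp

/-- The faces `σ ∘ δᵢ` are the restrictions along the coface vertex maps `Fin.succAbove i`
(Hatcher 2002, §2.1, `σ|[v₀, …, v̂ᵢ, …, vₙ]`). [cite: Hatcher2002, §2.1 boundary formula] -/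
lemma face_eq_vmap (i : Fin (n + 2)) (σ : SingularSimplex X (n + 1)) :
    σ.face i = σ.vmap (Fin.succAbove i) :=
  rfl

/-- The vertex map `j ↦ j` of the front `p`-face `[v₀, …, vₚ] ⊆ [v₀, …, vₙ]` (Hatcher 2002, §3.2,
definition of the cup product). [cite: Hatcher2002, §3.2 definition of the cup product] -/
def frontMap (p n : ℕ) (h : p ≤ n) : Fin (p + 1) → Fin (n + 1) := fun i => ⟨i, by omega⟩

/-- The vertex map `j ↦ j + (n - q)` of the back `q`-face `[vₙ₋q, …, vₙ] ⊆ [v₀, …, vₙ]`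
(Hatcher 2002, §3.2, definition of the cup product). [cite: Hatcher2002, §3.2 definition of the cup product] -/
def backMap (q n : ℕ) (h : q ≤ n) : Fin (q + 1) → Fin (n + 1) := fun i => ⟨i + (n - q), by omega⟩

/-- The front face is the restriction along `frontMap`. [cite: Hatcher2002, §3.2 definition of the cup product] -/
lemma frontFace_eq_vmap {p : ℕ} (h : p ≤ n) (σ : SingularSimplex X n) :
    σ.frontFace h = σ.vmap (frontMap p n h) :=
  rfl

/-- The back face is the restriction along `backMap`. [cite: Hatcher2002, §3.2 definition of the cup product] -/
lemma backFace_eq_vmap {q : ℕ} (h : q ≤ n) (σ : SingularSimplex X n) :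
    σ.backFace h = σ.vmap (backMap q n h) :=
  rfl

/-- Reversal exchanges front and back faces: `[v₀,…,vₚ]` of `σ̄` is `[vₙ,…,vₙ₋ₚ]`, the reversed
back `p`-face (Hatcher 2002, §3.2, proof of Thm. 3.11, the displayed formulas for
`ρ^*φ ⌣ ρ^*ψ` and `ρ^*(ψ ⌣ φ)`). [cite: Hatcher2002, §3.2 proof of Thm. 3.11] -/
lemma rev_comp_frontMap {p n : ℕ} (h : p ≤ n) :
    Fin.rev ∘ frontMap p n h = backMap p n h ∘ Fin.rev := by
  funext x
  apply Fin.ext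
  simp only [Function.comp_apply, Fin.val_rev, frontMap, backMap]
  omega

/-- Reversal exchanges back and front faces: `[vₙ₋q,…,vₙ]` of `σ̄` is `[v_q,…,v₀]`, the reversed
front `q`-face (Hatcher 2002, §3.2, proof of Thm. 3.11). [cite: Hatcher2002, §3.2 proof of Thm. 3.11] -/
lemma rev_comp_backMap {q n : ℕ} (h : q ≤ n) :
    Fin.rev ∘ backMap q n h = frontMap q n h ∘ Fin.rev := by
  funext x
  apply Fin.ext
  simp only [Function.comp_apply, Fin.val_rev, frontMap, backMap]
  omega

/-- Restriction along vertex maps commutes with push-forward along continuous maps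
(naturality). [folklore] -/
lemma vmap_map (f : C(X, Y)) (g : Fin (m + 1) → Fin (n + 1)) (σ : SingularSimplex X n) :
    (σ.map f).vmap g = (σ.vmap g).map f :=
  rfl

end SingularSimplex

/-! ### The reversal `ρ♯` and the twisted prism operator `P♯` on cochains -/

section Reversal

variable {R} {n m p q : ℕ}

/-- Hatcher's reversal on cochains, `ρ♯ : Cⁿ(X; R) → Cⁿ(X; R)`, `(ρ♯φ)(σ) = εₙ φ(σ|[vₙ, …, v₀])`,
the dual of the chain map `ρ(σ) = εₙ σ̄` (Hatcher 2002, §3.2, proof of Thm. 3.11). [cite: Hatcher2002, §3.2 proof of Thm. 3.11] -/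
def rhoCochain (n : ℕ) : (SingularSimplex X n → R) →ₗ[R] (SingularSimplex X n → R) where
  toFun φ σ := revSign R n * φ (σ.vmap Fin.rev)
  map_add' φ ψ := funext fun σ => by simp [mul_add]
  map_smul' r φ := funext fun σ => by simp [mul_left_comm]

/-- `(ρ♯φ)(σ) = εₙ φ(σ̄)`. [cite: Hatcher2002, §3.2 proof of Thm. 3.11] -/
@[simp]
lemma rhoCochain_apply (φ : SingularSimplex X n → R) (σ : SingularSimplex X n) :
    rhoCochain n φ σ = revSign R n * φ (σ.vmap Fin.rev) :=
  rfl

/-- The dual `P♯ : Cⁿ⁺¹(X; R) → Cⁿ(X; R)` of Hatcher's twisted prism operator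
`P(σ) = ∑ᵢ (-1)ⁱ εₙ₋ᵢ (σπ)|[v₀, …, vᵢ, wₙ, …, wᵢ]`, i.e.
`(P♯φ)(σ) = ∑ᵢ (-1)ⁱ εₙ₋ᵢ φ(σ ∘ [prismMap n i])` (Hatcher 2002, §3.2, proof of Thm. 3.11). [cite: Hatcher2002, §3.2 proof of Thm. 3.11] -/
def prismCochain (n : ℕ) : (SingularSimplex X (n + 1) → R) →ₗ[R] (SingularSimplex X n → R) where
  toFun φ σ := ∑ i : Fin (n + 1),
    ((-1 : R) ^ (i : ℕ) * revSign R (n - i)) * φ (σ.vmap (TwistedPrism.prismMap n i))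
  map_add' φ ψ := funext fun σ => by simp [Finset.sum_add_distrib, mul_add]
  map_smul' r φ := funext fun σ => by simp [Finset.mul_sum, mul_left_comm]

/-- The formula for `P♯`. [cite: Hatcher2002, §3.2 proof of Thm. 3.11] -/
@[simp]
lemma prismCochain_apply (φ : SingularSimplex X (n + 1) → R) (σ : SingularSimplex X n) :
    prismCochain n φ σ = ∑ i : Fin (n + 1),
      ((-1 : R) ^ (i : ℕ) * revSign R (n - i)) * φ (σ.vmap (TwistedPrism.prismMap n i)) :=
  rfl

/-- `ρ♯` is a cochain map: `δ ρ♯ = ρ♯ δ` (dual of `∂ρ = ρ∂`, Hatcher 2002, §3.2, proof of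
Thm. 3.11: the faces of `σ̄` are the reversed faces of `σ` in the opposite order, and
`εₙ₊₁ = (-1)ⁿ⁺¹ εₙ`). [cite: Hatcher2002, §3.2 proof of Thm. 3.11] -/
theorem d_rhoCochain (φ : SingularSimplex X n → R) :
    (singularCochainComplex R R X).d n (n + 1) (rhoCochain n φ) =
      rhoCochain (n + 1) ((singularCochainComplex R R X).d n (n + 1) φ) := by
  refine singularCochainComplex.ext fun σ => ?_
  change _ = revSign R (n + 1) * (singularCochainComplex R R X).d n (n + 1) φ (σ.vmap Fin.rev)
  simp only [singularCochainComplex.d_apply, rhoCochain_apply, smul_eq_mul, Finset.mul_sum,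
    SingularSimplex.face_eq_vmap, SingularSimplex.vmap_vmap]
  rw [← Equiv.sum_comp Fin.revPerm]
  refine Finset.sum_congr rfl fun i _ => ?_
  have e : Fin.succAbove (Fin.revPerm i) ∘ Fin.rev = Fin.rev ∘ Fin.succAbove i := by
    funext x
    simp [Fin.rev_succAbove]
  have hi : (i : ℕ) < n + 2 := i.isLt
  have hs : (-1 : R) ^ (n + 1 + 1 - ((i : ℕ) + 1)) = (-1 : R) ^ (n + 1) * (-1 : R) ^ (i : ℕ) := by
    rw [← pow_add]
    exact neg_one_pow_congr R (by omega)
  rw [e, Fin.revPerm_apply, Fin.val_rev, revSign_succ]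
  simp only [SimplexCategory.len_mk]
  rw [hs]
  ring

/-- **The chain homotopy** `P♯δ + δP♯ = ρ♯ - 𝟙` on `Cᵐ⁺¹(X; R)` (dual of `∂P + P∂ = ρ - 𝟙`,
Hatcher 2002, §3.2, proof of Thm. 3.11), evaluated at a simplex `σ`:
`(P♯δφ)(σ) + (δP♯φ)(σ) = εₘ₊₁ φ(σ̄) - φ(σ)`. Expanding the left-hand side gives exactly the twisted
prism identity `TwistedPrism.sum_eq_mul` for `F(g) = φ(σ ∘ [g])`. [cite: Hatcher2002, §3.2 proof of Thm. 3.11] -/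
theorem prismCochain_d_add_d_prismCochain (φ : SingularSimplex X (m + 1) → R)
    (σ : SingularSimplex X (m + 1)) :
    prismCochain (m + 1) ((singularCochainComplex R R X).d (m + 1) (m + 1 + 1) φ) σ +
      (singularCochainComplex R R X).d m (m + 1) (prismCochain m φ) σ =
      revSign R (m + 1) * φ (σ.vmap Fin.rev) - φ σ := by
  simp only [singularCochainComplex.d_apply, prismCochain_apply, smul_eq_mul, Finset.mul_sum,
    SingularSimplex.face_eq_vmap, SingularSimplex.vmap_vmap]
  have h := TwistedPrism.sum_eq_mul R (m := m) (fun g => φ (σ.vmap g))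
  simp only [SingularSimplex.vmap_id] at h
  exact h

/-- In degree `0`, `ρ♯ = 𝟙` (`ε₀ = 1` and a `0`-simplex has one vertex). [cite: Hatcher2002, §3.2 proof of Thm. 3.11] -/
lemma rhoCochain_zero (φ : SingularSimplex X 0 → R) : rhoCochain 0 φ = φ := by
  funext σ
  rw [rhoCochain_apply, revSign_zero, one_mul]
  have e : (Fin.rev : Fin 1 → Fin 1) = id := funext fun x => Subsingleton.elim _ _
  rw [e, SingularSimplex.vmap_id]

open singularCochainComplex

/-- `ρ♯` of a cocycle is a cocycle (`ρ♯` is a cochain map). [cite: Hatcher2002, §3.2 proof of Thm. 3.11] -/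
lemma d_rhoCochain_iCocycles (a : cocycles R R X n) :
    (singularCochainComplex R R X).d n (n + 1) (rhoCochain n (iCocycles R R X n a)) = 0 := by
  rw [d_rhoCochain, d_iCocycles]
  exact map_zero _

/-- The cocycle `ρ♯a` for a cocycle `a ∈ Zⁿ(X; R)` (Hatcher 2002, §3.2, proof of Thm. 3.11:
`ρ` "induces" a map on cohomology). [cite: Hatcher2002, §3.2 proof of Thm. 3.11] -/
def rhoCocycle (a : cocycles R R X n) : cocycles R R X n :=
  cocyclesMk (rhoCochain (R := R) (X := X) n (iCocycles R R X n a)) (d_rhoCochain_iCocycles a)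

/-- The underlying cochain of `rhoCocycle a` is `ρ♯` of the underlying cochain of `a`. [cite: Hatcher2002, §3.2 proof of Thm. 3.11] -/
@[simp]
lemma iCocycles_rhoCocycle (a : cocycles R R X n) :
    iCocycles R R X n (rhoCocycle a) = rhoCochain n (iCocycles R R X n a) :=
  iCocycles_mk _ (d_rhoCochain_iCocycles a)

/-- **`ρ^* = 𝟙` on cohomology**: `[ρ♯a] = [a]` in `Hⁿ(X; R)`, since `ρ♯a - a = δ(P♯a)` for a
cocycle `a` (Hatcher 2002, §3.2, proof of Thm. 3.11: "`ρ` is chain homotopic to the identity, so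
it induces the identity on cohomology"). [cite: Hatcher2002, §3.2 proof of Thm. 3.11] -/
theorem π_rhoCocycle (a : cocycles R R X n) :
    singularCohomology.π R R X n (rhoCocycle a) = singularCohomology.π R R X n a := by
  cases n with
  | zero =>
    congr 1
    exact cocycles_ext (by rw [iCocycles_rhoCocycle, rhoCochain_zero])
  | succ m =>
    have h0 : prismCochain (R := R) (X := X) (m + 1)
        ((singularCochainComplex R R X).d (m + 1) (m + 1 + 1) (iCocycles R R X (m + 1) a)) = 0 := by
      rw [d_iCocycles]
      exact map_zero _
    have key : rhoCocycle a - a = toCocycles R R X m (m + 1)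
        (prismCochain (R := R) (X := X) m (iCocycles R R X (m + 1) a)) := by
      refine cocycles_ext ?_
      rw [map_sub, iCocycles_rhoCocycle, iCocycles_toCocycles]
      refine singularCochainComplex.ext fun σ => ?_
      have h := prismCochain_d_add_d_prismCochain (iCocycles R R X (m + 1) a) σ
      rw [h0, Pi.zero_apply, zero_add] at h
      rw [h]
      rfl
    rw [← sub_eq_zero, ← map_sub, key, π_toCocycles]

/-! ### Graded commutativity -/

/-- The cochain formula `ρ♯φ ⌣ ρ♯ψ = (-1)^{pq} ρ♯(ψ ⌣ φ)` for `φ ∈ Cᵖ`, `ψ ∈ Cᵠ`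
(Hatcher 2002, §3.2, proof of Thm. 3.11: the two displayed formulas, commutativity of `R`,
and `ε_{p+q} = (-1)^{pq} ε_p ε_q`). [cite: Hatcher2002, §3.2 proof of Thm. 3.11] -/
theorem cochainCup_rhoCochain (h : p + q = n) (h' : q + p = n) (φ : SingularSimplex X p → R)
    (ψ : SingularSimplex X q → R) :
    cochainCup h (rhoCochain p φ) (rhoCochain q ψ) =
      ((-1 : R) ^ (p * q)) • rhoCochain n (cochainCup h' ψ φ) := by
  funext σ
  simp only [cochainCup_apply, rhoCochain_apply, Pi.smul_apply, smul_eq_mul]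
  rw [SingularSimplex.frontFace_eq_vmap (by omega : p ≤ n),
    SingularSimplex.backFace_eq_vmap (by omega : q ≤ n),
    SingularSimplex.frontFace_eq_vmap (by omega : q ≤ n),
    SingularSimplex.backFace_eq_vmap (by omega : p ≤ n)]
  simp only [SingularSimplex.vmap_vmap, SingularSimplex.rev_comp_frontMap,
    SingularSimplex.rev_comp_backMap]
  subst h
  rw [mul_mul_mul_comm, revSign_mul_revSign]
  ring

variable (R X) in
/-- **Graded commutativity of the cup product** (Hatcher 2002, Thm. 3.11, case `A = ∅`):
`a ⌣ b = (-1)^{pq} b ⌣ a` for `a ∈ Hᵖ(X; R)`, `b ∈ Hᵠ(X; R)`, `R` a commutative ring. This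
discharges the named fact `cupProduct_gradedComm` of
`Literature.AlgebraicTopology.SingularHomology.CupProduct`. Proof (Hatcher, proof of Thm. 3.11):
replace representing cocycles `a`, `b` by `ρ♯a`, `ρ♯b` (same classes, `π_rhoCocycle`), use
`ρ♯a ⌣ ρ♯b = (-1)^{pq} ρ♯(b ⌣ a)` (`cochainCup_rhoCochain`) and `[ρ♯(b ⌣ a)] = [b ⌣ a]`. [cite: Hatcher2002, Thm. 3.11] -/
theorem cupProduct_gradedComm_holds : cupProduct_gradedComm R X := by
  intro p q n h h' a b
  induction a using singularCohomology_induction_on with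
  | h a =>
  induction b using singularCohomology_induction_on with
  | h b =>
    conv_lhs => rw [← π_rhoCocycle a, ← π_rhoCocycle b, cupProduct_π_π]
    rw [cupProduct_π_π]
    have hc : cocyclesCup h (rhoCocycle a) (rhoCocycle b) =
        ((-1 : R) ^ (p * q)) • rhoCocycle (cocyclesCup h' b a) := by
      refine cocycles_ext ?_
      rw [iCocycles_cocyclesCup, iCocycles_rhoCocycle, iCocycles_rhoCocycle, map_smul,
        iCocycles_rhoCocycle, iCocycles_cocyclesCup]
      exact cochainCup_rhoCochain h h' _ _
    rw [hc, map_smul, π_rhoCocycle]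

end Reversal

end Literature.AlgebraicTopology.SingularHomology
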